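import Literature.AlgebraicGeometry.GroupSchemes.EtaleGroupSchemeConstant
import Literature.AlgebraicGeometry.GroupSchemes.AffineGroupSchemeSpecPoints
import Literature.AlgebraicGeometry.Motives.AbelianVarietyPurelyTranscendentalPoints   -- ★ `specOverMapOfAlgHom_comp_specOverMapOfAlgHom`
import HarnessLib

/-!
# Morphisms out of a finite étale group scheme over an algebraically closed field are decided by, and built from, their values on points
# ([Tate1997FiniteFlatGroupSchemes] (3.7); [StacksProject] Tag 00U3)

Topic `Literature/AlgebraicGeometry/GroupSchemes`; namespace `Literature.AlgebraicGeometry.GroupSchemes.EtaleHomOfPoints` (sequel of ★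
`EtaleGroupSchemeConstant`, ★ `AffineGroupSchemeSpecPoints`).  THEOREMS ONLY (no definition, no instance, no notation, no named fact, no `sorry`).
Cell `hodgecm-mathlib` (D-0151), programme P6 «MOD» (crux hLiu418 = stmt-HodgeConjecture-24832, `--supports`, count-neutral): organ **(U1)-brick** of the
(IMG) row of `stub_SPEC` (A-p06 (g36) 2026-09-02T10:40:49Z handoff; pen LA2-p02 (g2)): the layer `layerΩ I y` of the L2 leaflet is a finite étale group
scheme over `Ω̄`, so (i) a square of morphisms out of it commutes as soon as it commutes on `Ω̄`-points, and (ii) a morphism `layerΩ I y → Spec (Γ ⧸ J)` IS any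
prescribed function on `Ω̄`-points.  HC_CM is proved only modulo the printed citations until rung 0 closes; this file is generic and changes no count.

THE PRINT.  [Tate1997FiniteFlatGroupSchemes] (3.7): over `k = k̄` a finite étale group scheme «is» the constant group scheme on its points — ★
`EtaleGroupSchemeConstant.isIso_emb_top` (`Spec (k^{G(k)}) ≅ G`); hence morphisms `G → Y` are determined by their restrictions to the points (★
`hom_ext_of_sections`), and a morphism `Spec (k^{G(k)}) → Spec H` is the `Spec` of any family of `k`-algebra maps `H → k` indexed by `G(k)` ([StacksProject] Tag 00U3:
`Hom(Spec (k^I), Spec H) = Hom_k(H, k^I) = (Hom_k(H, k))^I`).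

## Contents
* §1 `hom_ext_of_points` — ★ `hom_ext_of_sections` in the tree's `specOver k k`-points currency (`Motives.AlgPoints` test object); `unitIsoSpecOver_inv_comp_constSection`.
* §2 **`exists_hom_specOver_comp_eq`** — for ANY function `Φ` from the points of `G` to the points of `Spec H` (`H` any `k`-algebra) there is `m : G ⟶ Spec H` over `k`
  with `x ≫ m = Φ x` for every point `x`; `existsUnique_hom_specOver_comp_eq` (with §1).

## References
* [Tate1997FiniteFlatGroupSchemes] J. Tate, *Finite flat group schemes*, in: Modular Forms and Fermat's Last Theorem (1997), (3.7).
* [StacksProject] The Stacks Project, Tag 00U3.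
* [GortzWedhorn2023] U. Görtz, T. Wedhorn, *Algebraic Geometry II* (2023), §(27.2) (p. 606).
-/

set_option autoImplicit false

-- Mathlib's `Over`/`Scheme` APIs are stated across semireducible wrappers (as in the ★ `GroupSchemes/*` files).
set_option backward.isDefEq.respectTransparency false

universe u

open CategoryTheory CategoryTheory.Limits AlgebraicGeometry MonoidalCategory CartesianMonoidalCategory
open scoped MonObj

noncomputable section

namespace Literature.AlgebraicGeometry.GroupSchemes

namespace EtaleHomOfPoints

open ConstantGroupScheme ConstantSubgroupOfSections EtaleGroupSchemeConstant AffineGroupScheme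
open Literature.AlgebraicGeometry.Motives (SchemeOver specOver AlgPoints)

variable {k : Type u} [Field k] (G : Over (Spec (.of k))) [GrpObj G]

/-! ## §1 Morphisms out of a finite étale group scheme are decided on points -/

/-- **MORPHISMS OUT OF A FINITE ÉTALE GROUP SCHEME OVER `k = k̄` AGREEING ON ALL `k`-POINTS ARE EQUAL** — ★ `hom_ext_of_sections` read on the test object
`specOver k k` (★ `unitIsoSpecOver : 𝟙_ ≅ specOver k k`); the target `Y` is an arbitrary `k`-scheme. [cite: Tate1997FiniteFlatGroupSchemes, (3.7)] -/
theorem hom_ext_of_points [IsAlgClosed k] [IsFinite G.hom] [Etale G.hom] {Y : Over (Spec (.of k))} (f g : G ⟶ Y)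
    (h : ∀ x : specOver k k ⟶ G, x ≫ f = x ≫ g) : f = g :=
  hom_ext_of_sections G f g fun s => by
    simpa only [Category.assoc, cancel_epi] using h (unitIsoSpecOver.inv ≫ s)

/-! ## §2 Morphisms into an affine `k`-scheme are built from their values on points -/

/-- The tautological section `σ_s` of the constant scheme `Spec (k^I)`, read on the test object `specOver k k`, is `Spec` of the evaluation `k^I → k` at `s`.
[cite: Tate1997FiniteFlatGroupSchemes, (3.7)] -/
theorem unitIsoSpecOver_inv_comp_constSection {I : Type u} (s : I) :
    unitIsoSpecOver.inv ≫ constSection k s = AlgPoints.specOverMapOfAlgHom (Pi.evalAlgHom k (fun _ : I => k) s) := by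
  apply Over.OverMorphism.ext
  rw [Over.comp_left, constSection_left, AlgPoints.specOverMapOfAlgHom_left]
  have hinv : (unitIsoSpecOver (R := k)).inv.left = 𝟙 _ := by
    rw [← cancel_epi (unitIsoSpecOver (R := k)).hom.left, ← Over.comp_left, Iso.hom_inv_id, Over.id_left, unitIsoSpecOver_hom_left,
      Category.comp_id]
    rfl
  rw [hinv, Category.id_comp]
  rfl

/-- **A MORPHISM INTO `Spec H` WITH PRESCRIBED VALUES ON POINTS**: for `G` a finite étale group scheme over `k = k̄`, `H` any `k`-algebra and ANY function
`Φ` from the `k`-points of `G` to the `k`-points of `Spec H`, there is `m : G ⟶ Spec H` over `k` with `x ≫ m = Φ x` for every `k`-point `x` — namely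
`(Spec (k^{G(k)}) ≅ G)⁻¹ ≫ Spec (H → k^{G(k)}, a ↦ (Φ(x)♯ a)_x)` (★ `isIso_emb_top`, ★ `constSection_comp_emb`, ★ `eq_specOverMapOfAlgHom`).
[cite: Tate1997FiniteFlatGroupSchemes, (3.7)] [cite: StacksProject, Tag 00U3] -/
theorem exists_hom_specOver_comp_eq [IsAlgClosed k] [IsFinite G.hom] [Etale G.hom] (H : Type u) [CommRing H] [Algebra k H]
    (Φ : (specOver k k ⟶ G) → (specOver k k ⟶ specOver k H)) :
    ∃ m : G ⟶ specOver k H, ∀ x : specOver k k ⟶ G, x ≫ m = Φ x := by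
  classical
  haveI : IsAffine G.left := isAffine_of_isAffineHom G.hom
  haveI : IsAffine (specOver k H).left := inferInstanceAs (IsAffine (Spec (CommRingCat.of H)))
  haveI := isIso_emb_top G
  -- the algebra map of the point `Φ (s)`, for each section `s`, read through `Γ(Spec H) ≅ H`
  let χ : ↥(⊤ : Subgroup (𝟙_ (Over (Spec (.of k))) ⟶ G)) → (H →ₐ[k] k) := fun s =>
    (ptEquiv (specOver k H) k (Φ (unitIsoSpecOver.inv ≫ s.1))).comp (algSpecOverEquiv H).symm.toAlgHom
  -- `H → k^{G(k)}` and its `Spec`, a morphism `Spec (k^{G(k)}) → Spec H` over `k` (`constOver k _` IS `specOver k (_ → k)`)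
  let ψ : H →ₐ[k] (↥(⊤ : Subgroup (𝟙_ (Over (Spec (.of k))) ⟶ G)) → k) := AlgHom.pi χ
  let d : constOver k ↥(⊤ : Subgroup (𝟙_ (Over (Spec (.of k))) ⟶ G)) ⟶ specOver k H := AlgPoints.specOverMapOfAlgHom ψ
  refine ⟨inv (emb G (⊤ : Subgroup (𝟙_ (Over (Spec (.of k))) ⟶ G))) ≫ d, fun x => ?_⟩
  -- `x` is the section `s := (𝟙_ ≅ specOver k k) ≫ x`, and `s = σ_s ≫ emb`
  let s : ↥(⊤ : Subgroup (𝟙_ (Over (Spec (.of k))) ⟶ G)) := ⟨unitIsoSpecOver.hom ≫ x, Subgroup.mem_top _⟩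
  have hx : x = unitIsoSpecOver.inv ≫ s.1 := by
    change x = unitIsoSpecOver.inv ≫ unitIsoSpecOver.hom ≫ x
    rw [Iso.inv_hom_id_assoc]
  have hs : s.1 = constSection k s ≫ emb G ⊤ := (constSection_comp_emb G ⊤ s).symm
  have hev : (Pi.evalAlgHom k (fun _ : ↥(⊤ : Subgroup (𝟙_ (Over (Spec (.of k))) ⟶ G)) => k) s).comp ψ = χ s := by
    ext a; rfl
  calc x ≫ inv (emb G ⊤) ≫ d
      = unitIsoSpecOver.inv ≫ (constSection k s ≫ emb G ⊤) ≫ inv (emb G ⊤) ≫ d := by rw [hx, hs]; simp only [Category.assoc]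
    _ = (unitIsoSpecOver.inv ≫ constSection k s) ≫ d := by simp only [Category.assoc, IsIso.hom_inv_id_assoc]
    _ = AlgPoints.specOverMapOfAlgHom (χ s) := by
          rw [unitIsoSpecOver_inv_comp_constSection, Literature.AlgebraicGeometry.Motives.specOverMapOfAlgHom_comp_specOverMapOfAlgHom, hev]
    _ = Φ x := by
          rw [hx]
          exact (eq_specOverMapOfAlgHom (Φ (unitIsoSpecOver.inv ≫ s.1))).symm

/-- **… AND IT IS UNIQUE** (§1): morphisms `G ⟶ Spec H` over `k` correspond EXACTLY to functions on `k`-points. [cite: Tate1997FiniteFlatGroupSchemes, (3.7)] -/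
theorem existsUnique_hom_specOver_comp_eq [IsAlgClosed k] [IsFinite G.hom] [Etale G.hom] (H : Type u) [CommRing H] [Algebra k H]
    (Φ : (specOver k k ⟶ G) → (specOver k k ⟶ specOver k H)) :
    ∃! m : G ⟶ specOver k H, ∀ x : specOver k k ⟶ G, x ≫ m = Φ x := by
  obtain ⟨m, hm⟩ := exists_hom_specOver_comp_eq G H Φ
  exact ⟨m, hm, fun m' hm' => hom_ext_of_points G m' m fun x => by rw [hm x, hm' x]⟩

end EtaleHomOfPoints

end Literature.AlgebraicGeometry.GroupSchemes

end
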